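/-
Copyright (c) 2026 the pub-hodgecm-mathlib formalisation cell (harness21).  Prover seat hodgecm-mathlib-K2E4-p14 (g6), Track B ∕ K2-LIT, h413 =
`stmt-HodgeConjecture-24833`, line `K2_E1_TraceFormulaBeta`, rung (ρ2) G7@χ̃=1 «CONSTANT LINE RESIDUAL» (dealer K2E1-plan (g5) 2026-09-04T08:30:34Z; (δ) memo fe64988a §3).
-/
import Summits.HodgeConjecture.HodgeConjecture.Theorems.K2E1CuspidalSpectrumUnitaryDefs   -- ★ `residualPart`, `residualSubspace`, `cmResidualSubspace`, ★ `cuspForms`∕`cuspidalSubspace`, ★ `discreteSpectrum`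
import Mathlib.MeasureTheory.Function.L2Space
import Mathlib.MeasureTheory.Function.LpSpace.DomAct.Basic
import Mathlib.RingTheory.SimpleModule.Rank
import Mathlib.Topology.Algebra.Module.FiniteDimension
import HarnessLib

/-!
# K2·E1 — `K2E1ConstantLineResidualU2`: THE CONSTANT LINE IS RESIDUAL — `ℂ·𝟙 ≤ L²_res = L²_disc ⊓ (L²_cusp)ᗮ` ON `G(K)A_G∖G(𝔸_K)`, MODULO «CUSP FORMS HAVE MEAN ZERO»

Track B ∕ K2-LIT, crux h413 = `stmt-HodgeConjecture-24833`, route of record `HCCMUnconditional`; cell `hodgecm-mathlib`, squad K2, ENGINE E1.  Prover seat `hodgecm-mathlib-K2E4-p14` (g6);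
rung (ρ2) «residual ∋ constants» of the R8 ladder toward 5Res (dealer K2E1-plan (g5) 08:30:34Z).  THEOREMS ONLY (no `def`, no `instance`, no notation, no named-fact hypothesis, no
`sorry`); lane `--supports stmt-HodgeConjecture-24833 --as helper` (count-neutral).  Closes no socket.

THE MATHEMATICS [MoeglinWaldspurger1995, I.2.18; BorelJacquet1979, §4.6; Borel1963, §5].  On the automorphic quotient of ANY `𝒢 : AdelicGroupData K` with an automorphic (finite, invariant)
measure `μ`, the constant function `𝟙` is square-integrable (`μ` finite — Borel–Harish-Chandra), fixed by the regular representation, and spans a ONE-dimensional closed invariant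
subspace — hence an irreducible closed subrepresentation, hence inside the discrete spectrum `L²_disc` (★ `le_discretePart`): clause (i), LETTER-FREE.  Clause (ii), `𝟙 ⟂ L²_cusp`:
the cuspidal subspace is the `L²`-closure of the continuous square-integrable cusp forms (★ `cuspidalSubspace`), and `⟪𝟙, φ⟫ = ∫ φ dμ`; so (ii) is EXACTLY «every cusp form has mean
zero», which is what the unfolding `∫_{G(K)∖G(𝔸)} φ = ∫_{N(𝔸)G(K)∖G(𝔸)} φ_N = 0` pays (Weil's formula on the automorphic quotient) — taken here as the ONE LETTER `hmean` (payer: the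
unfolding file).  HEAD **`span_const_le_residualSubspace`**: `ℂ ∙ 𝟙 ≤ L²_res(𝒢, μ, 𝔓)` modulo `hmean`, for every family of radicals `𝔓`; CM instance **`span_const_le_cmResidualSubspace`**
for the quasi-split `U(Φ_N)` over `L⁺`, EVERY `N` (nothing is `N = 2`-specific; the file name records the deal).  §1 `𝟙 ∈ L²`, `R(g)𝟙 = 𝟙`, `𝟙 ≠ 0`; §2 the line `ℂ·𝟙` as an
irreducible closed subrepresentation and clause (i) `span_const_le_discreteSpectrum` (letter-free); §3 clause (ii) and the heads.
HONEST LABEL: HC_CM is proved only modulo the 7 printed citations (2 remaining named inputs: hLiu418 = `stmt-HodgeConjecture-24832`, h413 = `stmt-HodgeConjecture-24833`) until rung 0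
closes; this file asserts no named fact and closes no socket; clause (ii) and the heads are conditional by construction on `hmean`.
References: [MoeglinWaldspurger1995] C. Mœglin, J.-L. Waldspurger, *Spectral Decomposition and Eisenstein Series* (1995), I.2.18 · [BorelJacquet1979] A. Borel, H. Jacquet,
*Automorphic forms and automorphic representations*, Corvallis (1979), §4.4–§4.6 · [Borel1963] A. Borel, *Some finiteness properties of adele groups over number fields* (1963), §5 ·
[Dixmier1977] J. Dixmier, *C\*-algebras* (1977), §13.1.
-/

set_option autoImplicit false
-- the mandated namespace repeats the single-problem summit's segment (`HodgeConjecture.HodgeConjecture`)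
set_option linter.dupNamespace false

noncomputable section

open MeasureTheory Measure NumberField ContRepresentation
open scoped InnerProductSpace ComplexConjugate ENNReal
open Literature.NumberTheory.Automorphic Literature.NumberTheory.Automorphic.UnitaryGroup
open Summit.HodgeConjecture.HodgeConjecture.Cruxes.H413.K2E1CuspidalSpectrumUnitary

namespace Summit.HodgeConjecture.HodgeConjecture.Cruxes.H413.K2E1ConstantLineResidualU2

universe u

section Generic

variable {K : Type} [Field K] [NumberField K] (𝒢 : AdelicGroupData.{u} K) (μ : Measure 𝒢.automorphicQuotient) [𝒢.IsAutomorphicMeasure μ]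

/-! ## §1 The constant function in `L²(G(K)A_G∖G(𝔸_K), μ)` -/

/-- **`R(g)𝟙 = 𝟙`**: the regular representation fixes the constants (Mathlib `DomMulAct.smul_Lp_const`). [cite: BorelJacquet1979, §4.6] -/
theorem rightRegular_const (g : 𝒢.Adelic) (c : ℂ) : 𝒢.rightRegular μ g (Lp.const 2 μ c) = Lp.const 2 μ c := by
  rw [AdelicGroupData.rightRegular_apply, DomMulAct.smul_Lp_const]

/-- **`𝟙 ≠ 0` in `L²`**: the automorphic measure is positive on the (non-empty, open) quotient. [cite: Borel1963, §5] -/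
theorem const_one_ne_zero : (Lp.const 2 μ (1 : ℂ) : 𝒢.L2 μ) ≠ 0 := by
  have hμ : μ Set.univ ≠ 0 := (isOpen_univ.measure_pos μ ⟨𝒢.toAutomorphicQuotient 1, Set.mem_univ _⟩).ne'
  haveI : NeZero μ := ⟨fun h => hμ (by rw [h, Measure.coe_zero, Pi.zero_apply])⟩
  intro h0
  have h1 := Lp.norm_const (p := (2 : ℝ≥0∞)) (μ := μ) (c := (1 : ℂ)) two_ne_zero
  rw [h0, norm_zero, norm_one, one_mul] at h1
  have hpos : 0 < μ.real Set.univ := ENNReal.toReal_pos hμ (measure_ne_top μ _)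
  exact (Real.rpow_pos_of_pos hpos _).ne' h1.symm

/-! ## §2 The line `ℂ·𝟙` is an irreducible closed subrepresentation; clause (i) `ℂ·𝟙 ≤ L²_disc` -/

/-- **THE CONSTANT LINE AS AN IRREDUCIBLE CLOSED SUBREPRESENTATION**: there is a closed subrepresentation `W` of the regular representation with `W = ℂ ∙ 𝟙` (invariant by §1, closed because
finite-dimensional) and `W` topologically irreducible (one-dimensional: every submodule is `⊥` or `⊤`). [cite: Dixmier1977, §13.1] [cite: BorelJacquet1979, §4.6] -/
theorem exists_closedSubrep_span_const :
    ∃ W : ClosedSubrep (𝒢.rightRegular μ), W.toSubmodule = (ℂ ∙ (Lp.const 2 μ (1 : ℂ) : 𝒢.L2 μ)) ∧ W.toContRep.IsTopIrreducible := by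
  have h1 := const_one_ne_zero 𝒢 μ
  -- the closed invariant line (invariant by §1, closed because finite-dimensional)
  obtain ⟨W, hW⟩ : ∃ W : ClosedSubrep (𝒢.rightRegular μ), W.toSubmodule = (ℂ ∙ (Lp.const 2 μ (1 : ℂ) : 𝒢.L2 μ)) := by
    refine ⟨⟨⟨ℂ ∙ (Lp.const 2 μ (1 : ℂ) : 𝒢.L2 μ), fun g v hv => ?_⟩, Submodule.closed_of_finiteDimensional _⟩, rfl⟩
    obtain ⟨a, rfl⟩ := Submodule.mem_span_singleton.1 hv
    change 𝒢.rightRegular μ g (a • Lp.const 2 μ (1 : ℂ)) ∈ ℂ ∙ (Lp.const 2 μ (1 : ℂ) : 𝒢.L2 μ)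
    rw [map_smul, rightRegular_const]
    exact Submodule.smul_mem _ a (Submodule.mem_span_singleton_self _)
  refine ⟨W, hW, ?_⟩
  -- one-dimensional, hence topologically irreducible
  have hmem : (Lp.const 2 μ (1 : ℂ) : 𝒢.L2 μ) ∈ W.toSubmodule := by
    rw [hW]
    exact Submodule.mem_span_singleton_self _
  have hfr : Module.finrank ℂ ↥W.toSubmodule = 1 := (LinearEquiv.ofEq _ _ hW).finrank_eq.trans (finrank_span_singleton h1)
  haveI : IsSimpleModule ℂ ↥W.toSubmodule := isSimpleModule_iff_finrank_eq_one.2 hfr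
  refine (ContRepresentation.isTopIrreducible_iff _).2 ⟨⟨⟨⟨_, hmem⟩, 0, fun h => h1 (congrArg Subtype.val h)⟩⟩, fun W' => ?_⟩
  rcases eq_bot_or_eq_top W'.toSubmodule with h | h
  · left
    refine ClosedSubrep.ext fun v => ?_
    rw [← ClosedSubrep.mem_toSubmodule (W := W'), h, Submodule.mem_bot, ClosedSubrep.mem_bot]
  · right
    refine ClosedSubrep.ext fun v => ?_
    rw [← ClosedSubrep.mem_toSubmodule (W := W'), h]
    exact ⟨fun _ => ClosedSubrep.mem_top v, fun _ => Submodule.mem_top⟩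

/-- **CLAUSE (i), LETTER-FREE: `ℂ ∙ 𝟙 ≤ L²_disc`** — an irreducible closed subrepresentation lies in the discrete spectrum (★ `le_discretePart`). [cite: BorelJacquet1979, §4.6]
[cite: MoeglinWaldspurger1995, I.2.18] -/
theorem span_const_le_discreteSpectrum : (ℂ ∙ (Lp.const 2 μ (1 : ℂ) : 𝒢.L2 μ)) ≤ (𝒢.discreteSpectrum μ).toSubmodule := by
  obtain ⟨W, hW, hirr⟩ := exists_closedSubrep_span_const 𝒢 μ
  rw [← hW]
  exact ClosedSubrep.toSubmodule_le_iff.2 (le_discretePart hirr)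

/-! ## §3 Clause (ii) `𝟙 ⟂ L²_cusp` modulo «cusp forms have mean zero», and the heads -/

/-- **`⟪𝟙, u⟫ = ∫ u dμ`** on `L²` of a finite measure (Mathlib `L2.inner_indicatorConstLp_one` at `s = univ`). [folklore] -/
theorem inner_const_one_left (u : 𝒢.L2 μ) : ⟪(Lp.const 2 μ (1 : ℂ) : 𝒢.L2 μ), u⟫_ℂ = ∫ x, u x ∂μ := by
  rw [← indicatorConstLp_univ, L2.inner_indicatorConstLp_one, Measure.restrict_univ]

/-- **CLAUSE (ii) MODULO `hmean`: `L²_cusp ≤ (ℂ ∙ 𝟙)ᗮ`** — if every continuous square-integrable cusp form has mean zero (`hmean`, the unfolding along `N(K)∖N(𝔸)`), then the cuspidal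
subspace (the `L²`-CLOSURE of their classes) is orthogonal to the constants: `⟪𝟙, φ⟫ = ∫ φ = 0` on the generators and `(ℂ ∙ 𝟙)ᗮ` is closed (★ `toSubmodule_cuspidalSubspace`, Mathlib
`Submodule.topologicalClosure_minimal`). [cite: MoeglinWaldspurger1995, I.2.18] [cite: BorelJacquet1979, §4.4–§4.6] -/
theorem cuspidalSubspace_le_orthogonal_span_const (𝔓 : 𝒢.ParabolicUnipotentData) (hmean : ∀ φ ∈ 𝒢.cuspForms μ 𝔓, ∫ x, φ x ∂μ = 0) :
    (𝒢.cuspidalSubspace μ 𝔓).toSubmodule ≤ (ℂ ∙ (Lp.const 2 μ (1 : ℂ) : 𝒢.L2 μ))ᗮ := by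
  rw [AdelicGroupData.toSubmodule_cuspidalSubspace]
  refine Submodule.topologicalClosure_minimal _ (fun u hu => ?_) (Submodule.isClosed_orthogonal _)
  obtain ⟨φ, rfl⟩ := hu
  rw [Submodule.mem_orthogonal_singleton_iff_inner_right, inner_const_one_left, AdelicGroupData.cuspFormsToLp_apply, integral_congr_ae (MemLp.coeFn_toLp _)]
  exact hmean φ φ.2

/-- **HEAD — THE CONSTANT LINE IS RESIDUAL: `ℂ ∙ 𝟙 ≤ L²_res = L²_disc ⊓ (L²_cusp)ᗮ`** for every `𝒢 : AdelicGroupData K`, automorphic `μ` and family of radicals `𝔓`, modulo the ONE letter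
`hmean` («cusp forms have mean zero» = the unfolding along `N(K)∖N(𝔸)`): clause (i) ★ `le_discretePart` on the one-dimensional invariant line (§2, letter-free), clause (ii) §3.
This is rung «residual ∋ constants» (the existence half of `L²_res ∩ sph ⊇ ℂ`). [cite: MoeglinWaldspurger1995, I.2.18] [cite: BorelJacquet1979, §4.6] -/
theorem span_const_le_residualSubspace (𝔓 : 𝒢.ParabolicUnipotentData) (hmean : ∀ φ ∈ 𝒢.cuspForms μ 𝔓, ∫ x, φ x ∂μ = 0) :
    (ℂ ∙ (Lp.const 2 μ (1 : ℂ) : 𝒢.L2 μ)) ≤ (residualSubspace 𝒢 μ 𝔓).toSubmodule := by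
  change _ ≤ (𝒢.discreteSpectrum μ).toSubmodule ⊓ (𝒢.cuspidalSubspace μ 𝔓).toSubmoduleᗮ
  exact le_inf (span_const_le_discreteSpectrum 𝒢 μ)
    ((Submodule.le_orthogonal_orthogonal _).trans (Submodule.orthogonal_le (cuspidalSubspace_le_orthogonal_span_const 𝒢 μ 𝔓 hmean)))

end Generic

section CM

variable (L : Type) [Field L] [NumberField L] [IsCMField L] (N : ℕ)
  (μ : Measure (UnitaryGroup.cmDatum L N (Matrix.of fun i j : Fin N => if i.val + j.val + 1 = N then (1 : L) else 0)).automorphicQuotient)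
  [(UnitaryGroup.cmDatum L N (Matrix.of fun i j : Fin N => if i.val + j.val + 1 = N then (1 : L) else 0)).IsAutomorphicMeasure μ]

/-- **HEAD AT THE CM INSTANCE — `ℂ ∙ 𝟙 ≤ L²_res(U(Φ_N)_{L∕L⁺})`** (★ `cmResidualSubspace`, every `N`) modulo the one letter `hmean` on the CM cusp forms ★ `cmCuspForms`: the constant
line of `L²(U(Φ_N)(L⁺)∖U(Φ_N)(𝔸_{L⁺}))` is residual — rung (ρ2) «residual ∋ constants» at `χ̃ = 1`. [cite: MoeglinWaldspurger1995, I.2.18] [cite: Rogawski1990, §13.5] -/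
theorem span_const_le_cmResidualSubspace (hmean : ∀ φ ∈ cmCuspForms L N μ, ∫ x, φ x ∂μ = 0) :
    (ℂ ∙ (Lp.const 2 μ (1 : ℂ) : (UnitaryGroup.cmDatum L N (Matrix.of fun i j : Fin N => if i.val + j.val + 1 = N then (1 : L) else 0)).L2 μ)) ≤
      (cmResidualSubspace L N μ).toSubmodule :=
  span_const_le_residualSubspace _ μ (cmParabolicData L N) hmean

/-- **CLAUSE (i) AT THE CM INSTANCE, LETTER-FREE — `ℂ ∙ 𝟙 ≤ L²_disc(U(Φ_N)_{L∕L⁺})`**. [cite: BorelJacquet1979, §4.6] [cite: Rogawski1990, §13.5] -/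
theorem span_const_le_cmDiscreteSpectrum :
    (ℂ ∙ (Lp.const 2 μ (1 : ℂ) : (UnitaryGroup.cmDatum L N (Matrix.of fun i j : Fin N => if i.val + j.val + 1 = N then (1 : L) else 0)).L2 μ)) ≤
      ((UnitaryGroup.cmDatum L N (Matrix.of fun i j : Fin N => if i.val + j.val + 1 = N then (1 : L) else 0)).discreteSpectrum μ).toSubmodule :=
  span_const_le_discreteSpectrum _ μ

end CM

end Summit.HodgeConjecture.HodgeConjecture.Cruxes.H413.K2E1ConstantLineResidualU2

end
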